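import Literature.NumberTheory.Automorphic.NewformAdelisation
import Literature.NumberTheory.EllipticCurves.Newforms
import Literature.NumberTheory.EllipticCurves.HeckeOperatorsProofs
import Literature.NumberTheory.EllipticCurves.HeckeOperatorsDiamondCommProofs
import Literature.NumberTheory.EllipticCurves.HeckeOperatorsGamma1QExpansionProofs
import HarnessLib

/-!
# Adelisation of classical modular forms, IV-b: the classical side of Gelbart's Lemma 3.7

Topic `NumberTheory/Automorphic`; the classical (upper half plane) half of layer E-IV of the
discharge plan of `Literature.NumberTheory.Automorphic.Gelbart1975_exists_adelicNewform` (lang.S24), feeding the named fact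
`adelicLift_heckeEigenvalues` of `NewformAdelisationLift`. For a newform `f ∈ S_k(Γ₁(N))`
(`IsNewform1`, eigenvalue `a_p = heckeEigenvalue f p`, nebentypus `χ = nebentypus f`) and a prime
`p ∤ N` we prove

* `sum_slash_heckeBeta_inv`: **`∑ⱼ f ∣[k] β_j⁻¹ = p^{2-k} a_p f`**, where the `p + 1` rational
  matrices `β_j ∈ GL₂(ℚ)` (`heckeBeta`) are `β_j = (p j; 0 1)` (`j < p`) and
  `β_∞ = (a b'; pN pd') = diag(1,p) (a b'; N d')` for Bezout data `a d' - b' N = 1`, `N ∣ a - p`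
  (`exists_bezout_level`; so `δ = (a b'; N d') ∈ Γ₀(N)`, `bezoutDelta`). These are the global
  matrices which, at `p`, are the local representatives `(p j; 0 1)`, `diag(1, p)` of
  `GL₂(ℤ_p) diag(p,1) GL₂(ℤ_p) / GL₂(ℤ_p)` (Bump (1997), (6.4), p. 494; Gelbart (1975), p. 31) and
  which lie in `K₁(N)_ℓ` at every `ℓ ≠ p` (this is checked in part IV-c); over `ℝ`,
  `β_j⁻¹ = p⁻¹ (1 -j; 0 p)` and `β_∞⁻¹ = p⁻¹ δ⁻¹ diag(p, 1)` (`map_castHom_heckeBeta_*_inv`, with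
  `tpB`, `tpD` of `HeckeOperatorsProofs`), so the identity is `p^{2-k}` (`slash_realScalarGL_mul`)
  times Diamond–Shurman's Prop. 5.2.1, `T_p f = ∑ⱼ f ∣ (1 j; 0 p) + (⟨p⟩ f) ∣ diag(p,1)` (the tree's
  `coe_heckeT_gamma1_eq_sum_of_not_dvd`), with `⟨p⟩ f = χ(p) f` and `f ∣ δ⁻¹ = χ(a) f = χ(p) f`
  (`slash_eq_nebentypus_smul_of_mem_gamma0`), and `T_p f = a_p f`;
* `sum_archLift_heckeBeta_inv_mul`: the same identity for the archimedean lift of part I,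
  **`∑ⱼ archLift k f (β_j⁻¹ x) = (a_p / (√p)^{k-2}) archLift k f x`** for `det x > 0` — the
  normalisation `p^{1-k/2} a_p` of Gelbart's Lemma 3.7 (`p^{k/2-1} T̃(p) φ_f = φ_{T(p) f}`).

The only hypothesis is the trunk's named fact `IsNewform1.mem_nebentypusSubspace_nebentypus`
(`f ∈ S_k(N, χ)`), which is proved in `LanglandsTunnellLSeriesProofs`
(`IsNewform1.mem_nebentypusSubspace_nebentypus_holds`); it is kept as a hypothesis `hB` to keep
this file's imports classical, and is fed in the assembly file. No named facts are introduced.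

## References

* S. Gelbart, *Automorphic forms on adele groups* (1975), §3.B, Lemma 3.7 and its proof, p. 31
  [Gelbart1975].
* F. Diamond, J. Shurman, *A first course in modular forms* (2005), §5.2, (5.2), Prop. 5.2.1,
  p. 168–171 [DiamondShurman2005].
* D. Bump, *Automorphic forms and representations* (1997), §3.6, p. 342; §4.6, (6.4), p. 494
  [Bump1997].
-/

noncomputable section

open Matrix.GeneralLinearGroup UpperHalfPlane
open scoped MatrixGroups ModularForm

namespace Literature.NumberTheory.Automorphic

open EllipticCurves.ModularForms CongruenceSubgroup

/-! ### The rational matrices `β_j` attached to the local representatives at `p ∤ N` -/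

section Beta

/-- **Bezout data at `p ∤ N`**: integers `a, b', d'` with `a d' - b' N = 1` and `N ∣ a - p`, so
that `δ = (a b'; N d') ∈ Γ₀(N)` has lower right entry `d' ≡ p⁻¹` and `δ⁻¹` has lower right entry
`a ≡ p (mod N)`. [folklore] -/
theorem exists_bezout_level (N p : ℕ) (hp : p.Prime) (hpN : ¬ p ∣ N) :
    ∃ a b' d' : ℤ, a * d' - b' * N = 1 ∧ (N : ℤ) ∣ a - p := by
  have hcop : IsCoprime (p : ℤ) (N : ℤ) := Nat.isCoprime_iff_coprime.2 ((Nat.Prime.coprime_iff_not_dvd hp).2 hpN)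
  obtain ⟨d', e, hde⟩ := hcop
  have hcop' : IsCoprime d' (N : ℤ) := ⟨p, e, by linarith⟩
  obtain ⟨a, b'', hab⟩ := hcop'
  refine ⟨a, -b'', d', by linarith, ⟨a * e - p * b'', ?_⟩⟩
  linear_combination (-a : ℤ) * hde + (p : ℤ) * hab

variable (p : ℕ) (a b' d' : ℤ) (N : ℕ)

/-- `(p j; 0 1)(p⁻¹ -j p⁻¹; 0 1) = 1`. [folklore] -/
theorem heckeBeta_some_mul_inv (hp : (p : ℚ) ≠ 0) (j : ℕ) :
    !![(p : ℚ), j; 0, 1] * !![(p : ℚ)⁻¹, -(j * (p : ℚ)⁻¹); 0, 1] = 1 := by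
  have hinv : (p : ℚ) * (p : ℚ)⁻¹ = 1 := mul_inv_cancel₀ hp
  rw [Matrix.mul_fin_two, Matrix.one_fin_two]
  ext r c
  fin_cases r <;> fin_cases c <;>
    simp only [Matrix.of_apply, Matrix.cons_val', Matrix.cons_val_zero, Matrix.cons_val_one, Matrix.empty_val',
      Matrix.cons_val_fin_one, Fin.isValue, Fin.mk_one, Fin.zero_eta]
  · linear_combination hinv
  · linear_combination (-(j : ℚ)) * hinv
  · ring1
  · ring1

/-- `(p⁻¹ -j p⁻¹; 0 1)(p j; 0 1) = 1`. [folklore] -/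
theorem heckeBeta_some_inv_mul (hp : (p : ℚ) ≠ 0) (j : ℕ) :
    !![(p : ℚ)⁻¹, -(j * (p : ℚ)⁻¹); 0, 1] * !![(p : ℚ), j; 0, 1] = 1 := by
  have hinv : (p : ℚ) * (p : ℚ)⁻¹ = 1 := mul_inv_cancel₀ hp
  rw [Matrix.mul_fin_two, Matrix.one_fin_two]
  ext r c
  fin_cases r <;> fin_cases c <;>
    simp only [Matrix.of_apply, Matrix.cons_val', Matrix.cons_val_zero, Matrix.cons_val_one, Matrix.empty_val',
      Matrix.cons_val_fin_one, Fin.isValue, Fin.mk_one, Fin.zero_eta]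
  · linear_combination hinv
  · ring1
  · ring1
  · ring1

/-- `(a b'; pN pd')(d' -b'p⁻¹; -N ap⁻¹) = 1` when `a d' - b' N = 1`. [folklore] -/
theorem heckeBeta_none_mul_inv (hp : (p : ℚ) ≠ 0) (h : (a : ℚ) * d' - b' * N = 1) :
    !![(a : ℚ), b'; (p : ℚ) * N, (p : ℚ) * d'] * !![(d' : ℚ), -(b' * (p : ℚ)⁻¹); -(N : ℚ), a * (p : ℚ)⁻¹] = 1 := by
  have hinv : (p : ℚ) * (p : ℚ)⁻¹ = 1 := mul_inv_cancel₀ hp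
  rw [Matrix.mul_fin_two, Matrix.one_fin_two]
  ext r c
  fin_cases r <;> fin_cases c <;>
    simp only [Matrix.of_apply, Matrix.cons_val', Matrix.cons_val_zero, Matrix.cons_val_one, Matrix.empty_val',
      Matrix.cons_val_fin_one, Fin.isValue, Fin.mk_one, Fin.zero_eta]
  · linear_combination h
  · ring1
  · ring1
  · linear_combination h + ((a : ℚ) * d' - N * b') * hinv

/-- `(d' -b'p⁻¹; -N ap⁻¹)(a b'; pN pd') = 1` when `a d' - b' N = 1`. [folklore] -/
theorem heckeBeta_none_inv_mul (hp : (p : ℚ) ≠ 0) (h : (a : ℚ) * d' - b' * N = 1) :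
    !![(d' : ℚ), -(b' * (p : ℚ)⁻¹); -(N : ℚ), a * (p : ℚ)⁻¹] * !![(a : ℚ), b'; (p : ℚ) * N, (p : ℚ) * d'] = 1 := by
  have hinv : (p : ℚ) * (p : ℚ)⁻¹ = 1 := mul_inv_cancel₀ hp
  rw [Matrix.mul_fin_two, Matrix.one_fin_two]
  ext r c
  fin_cases r <;> fin_cases c <;>
    simp only [Matrix.of_apply, Matrix.cons_val', Matrix.cons_val_zero, Matrix.cons_val_one, Matrix.empty_val',
      Matrix.cons_val_fin_one, Fin.isValue, Fin.mk_one, Fin.zero_eta]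
  · linear_combination h + (-((b' : ℚ) * N)) * hinv
  · linear_combination (-((b' : ℚ) * d')) * hinv
  · linear_combination ((a : ℚ) * N) * hinv
  · linear_combination h + ((a : ℚ) * d') * hinv

/-- The rational matrices `β_j`: `β_j = (p j; 0 1)` for `j < p` and `β_∞ = (a b'; pN, pd') =
diag(1, p) · (a b'; N d')` (Diamond–Shurman (5.2), up to the passage `β ↦ p β⁻¹`; Gelbart
(1975), proof of Lemma 3.7), with their inverses `(p⁻¹ -j p⁻¹; 0 1)`, `(d' -b' p⁻¹; -N, a p⁻¹)`. [folklore] -/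
def heckeBeta (hp : p ≠ 0) (had : a * d' - b' * N = 1) : Option (Fin p) → GL (Fin 2) ℚ
  | some j => ⟨!![(p : ℚ), (j : ℕ); 0, 1], !![(p : ℚ)⁻¹, -((j : ℕ) * (p : ℚ)⁻¹); 0, 1],
      heckeBeta_some_mul_inv p (by exact_mod_cast hp) j, heckeBeta_some_inv_mul p (by exact_mod_cast hp) j⟩
  | none => ⟨!![(a : ℚ), b'; (p : ℚ) * N, (p : ℚ) * d'], !![(d' : ℚ), -(b' * (p : ℚ)⁻¹); -(N : ℚ), a * (p : ℚ)⁻¹],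
      heckeBeta_none_mul_inv p a b' d' N (by exact_mod_cast hp) (by exact_mod_cast had),
      heckeBeta_none_inv_mul p a b' d' N (by exact_mod_cast hp) (by exact_mod_cast had)⟩

/-- Entries of `β_j`, `j < p`. [folklore] -/
@[simp]
theorem coe_heckeBeta_some (hp : p ≠ 0) (had : a * d' - b' * N = 1) (j : Fin p) :
    ((heckeBeta p a b' d' N hp had (some j) : GL (Fin 2) ℚ) : Matrix (Fin 2) (Fin 2) ℚ) = !![(p : ℚ), (j : ℕ); 0, 1] := rfl

/-- Entries of `β_j⁻¹`, `j < p`. [folklore] -/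
@[simp]
theorem coe_heckeBeta_some_inv (hp : p ≠ 0) (had : a * d' - b' * N = 1) (j : Fin p) :
    (((heckeBeta p a b' d' N hp had (some j))⁻¹ : GL (Fin 2) ℚ) : Matrix (Fin 2) (Fin 2) ℚ) =
      !![(p : ℚ)⁻¹, -((j : ℕ) * (p : ℚ)⁻¹); 0, 1] := rfl

/-- Entries of `β_∞`. [folklore] -/
@[simp]
theorem coe_heckeBeta_none (hp : p ≠ 0) (had : a * d' - b' * N = 1) :
    ((heckeBeta p a b' d' N hp had none : GL (Fin 2) ℚ) : Matrix (Fin 2) (Fin 2) ℚ) =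
      !![(a : ℚ), b'; (p : ℚ) * N, (p : ℚ) * d'] := rfl

/-- Entries of `β_∞⁻¹`. [folklore] -/
@[simp]
theorem coe_heckeBeta_none_inv (hp : p ≠ 0) (had : a * d' - b' * N = 1) :
    (((heckeBeta p a b' d' N hp had none)⁻¹ : GL (Fin 2) ℚ) : Matrix (Fin 2) (Fin 2) ℚ) =
      !![(d' : ℚ), -(b' * (p : ℚ)⁻¹); -(N : ℚ), a * (p : ℚ)⁻¹] := rfl

/-- `det β_j = p`. [folklore] -/
theorem val_det_heckeBeta (hp : p ≠ 0) (had : a * d' - b' * N = 1) (j : Option (Fin p)) :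
    (heckeBeta p a b' d' N hp had j).det.val = p := by
  cases j with
  | some j => rw [Matrix.GeneralLinearGroup.val_det_apply, coe_heckeBeta_some, Matrix.det_fin_two_of]; ring
  | none =>
    rw [Matrix.GeneralLinearGroup.val_det_apply, coe_heckeBeta_none, Matrix.det_fin_two_of]
    have h : (a : ℚ) * d' - b' * N = 1 := by exact_mod_cast had
    linear_combination (p : ℚ) * h

/-- The matrix `δ = (a b'; N d') ∈ SL₂(ℤ)` (in `Γ₀(N)`, lower right entry `d' ≡ p⁻¹ (mod N)`). [folklore] -/
def bezoutDelta (had : a * d' - b' * N = 1) : SL(2, ℤ) :=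
  ⟨!![a, b'; N, d'], by rw [Matrix.det_fin_two_of]; linarith⟩

/-- Entries of `δ`. [folklore] -/
@[simp]
theorem coe_bezoutDelta (had : a * d' - b' * N = 1) :
    ((bezoutDelta a b' d' N had : SL(2, ℤ)) : Matrix (Fin 2) (Fin 2) ℤ) = !![a, b'; N, d'] := rfl

/-- `β_∞ = diag(1, p) δ` over `ℚ` (`diagGL 1 p` of `HeckeOperators`). [folklore] -/
theorem heckeBeta_none_eq (hp : p ≠ 0) (had : a * d' - b' * N = 1) :
    heckeBeta p a b' d' N hp had none =
      ((diagGL 1 (p : ℚ) one_pos (Nat.cast_pos.mpr (Nat.pos_of_ne_zero hp)) : GL(2, ℚ)⁺) : GL (Fin 2) ℚ) *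
        Matrix.SpecialLinearGroup.mapGL ℚ (bezoutDelta a b' d' N had) := by
  ext i j
  rw [Units.val_mul, coe_heckeBeta_none, coe_coe_diagGL]
  change _ = (!![(1 : ℚ), 0; 0, p] * (!![(a : ℤ), b'; N, d']).map (Int.castRingHom ℚ)) i j
  fin_cases i <;> fin_cases j <;> simp [Matrix.mul_apply, Fin.sum_univ_two]

/-- `δ⁻¹ = (d' -b'; -N a) ∈ Γ₀(N)`. [folklore] -/
theorem bezoutDelta_inv_mem_gamma0 (had : a * d' - b' * N = 1) : (bezoutDelta a b' d' N had)⁻¹ ∈ Gamma0 N := by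
  rw [Gamma0_mem, Matrix.SpecialLinearGroup.coe_inv, coe_bezoutDelta, Matrix.adjugate_fin_two]
  simp

/-- The lower right entry of `δ⁻¹` is `a`. [folklore] -/
theorem bezoutDelta_inv_apply_one_one (had : a * d' - b' * N = 1) :
    (((bezoutDelta a b' d' N had)⁻¹ : SL(2, ℤ)) : Matrix (Fin 2) (Fin 2) ℤ) 1 1 = a := by
  rw [Matrix.SpecialLinearGroup.coe_inv, coe_bezoutDelta, Matrix.adjugate_fin_two]
  simp

/-- The real matrix of `δ⁻¹`: `(d' -b'; -N a)`. [folklore] -/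
theorem coe_GL_bezoutDelta_inv (had : a * d' - b' * N = 1) :
    ((((bezoutDelta a b' d' N had)⁻¹ : SL(2, ℤ)) : GL (Fin 2) ℝ) : Matrix (Fin 2) (Fin 2) ℝ) =
      !![(d' : ℝ), -b'; -N, a] := by
  ext r c
  change ((((bezoutDelta a b' d' N had)⁻¹ : SL(2, ℤ)) : Matrix (Fin 2) (Fin 2) ℤ) r c : ℝ) = _
  rw [Matrix.SpecialLinearGroup.coe_inv, coe_bezoutDelta, Matrix.adjugate_fin_two]
  fin_cases r <;> fin_cases c <;> simp

end Beta

/-! ### The nebentypus: `f ∣[k] γ = χ(d_γ) f` for `γ ∈ Γ₀(N)` -/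

section Nebentypus

variable {N : ℕ} [NeZero N] {k : ℤ}

/-- **`f ∣[k] γ = χ(d) f` for `γ = (a b; c d) ∈ Γ₀(N)`**, `χ = nebentypus f`, for a newform `f`,
granted the trunk's named fact `IsNewform1.mem_nebentypusSubspace_nebentypus` (`f ∈ S_k(N, χ)`,
i.e. `⟨d⟩ f = χ(d) f` for all units `d`; Diamond–Shurman §5.2, p. 168–169): `d` is a unit
(`isUnit_Gamma0Map`), `⟨d⟩ f = f ∣[k] γ_d` for the chosen lift `γ_d ∈ Γ₀(N)` of `d`
(`coe_cuspHeckeOperatorₗ_gamma1`) and `f ∣[k] γ_d = f ∣[k] γ` (`slash_mapGL_eq_of_Gamma0Map_eq`).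
(With `IsNewform1.mem_nebentypusSubspace_nebentypus_holds` of `LanglandsTunnellLSeriesProofs` the
hypothesis `hB` is discharged; it is kept as a hypothesis here to keep the imports classical.) [cite: DiamondShurman2005, §5.2 p. 168] -/
theorem slash_eq_nebentypus_smul_of_mem_gamma0 (hB : IsNewform1.mem_nebentypusSubspace_nebentypus (N := N) (k := k))
    {f : CuspForm (Gamma1 N) k} (hf : IsNewform1 f) {γ : SL(2, ℤ)} (hγ : γ ∈ Gamma0 N) :
    ⇑f ∣[k] (γ : GL (Fin 2) ℝ) = (nebentypus f) (((γ : Matrix (Fin 2) (Fin 2) ℤ) 1 1 : ℤ) : ZMod N) • ⇑f := by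
  have hu : IsUnit (Gamma0Map N ⟨γ, hγ⟩) := isUnit_Gamma0Map N ⟨γ, hγ⟩
  -- `⟨d⟩ f = χ(d) f`
  have hmem := hB hf
  rw [nebentypusSubspace, Submodule.mem_iInf] at hmem
  have h1 := hmem hu.unit
  rw [LinearMap.mem_ker, LinearMap.sub_apply, LinearMap.smul_apply, LinearMap.id_apply, sub_eq_zero,
    IsUnit.unit_spec] at h1
  have hex : ∃ γ' : Gamma0 N, Gamma0Map N γ' = Gamma0Map N ⟨γ, hγ⟩ := ⟨⟨γ, hγ⟩, rfl⟩
  rw [diamondOp, dif_pos hex] at h1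
  have h2 : (⇑(cuspHeckeOperatorₗ (Gamma1 N) k (slToGLPos (hex.choose : SL(2, ℤ))) f) : ℍ → ℂ) =
      (nebentypus f) (Gamma0Map N ⟨γ, hγ⟩) • ⇑f := by
    rw [h1, CuspForm.IsGLPos.coe_smul]
  rw [coe_cuspHeckeOperatorₗ_gamma1,
    ← slash_mapGL_eq_of_Gamma0Map_eq (N := N) (x := ⟨γ, hγ⟩) (y := hex.choose) (h := hex.choose_spec.symm) (F := f)] at h2
  exact h2

end Nebentypus

/-! ### Slash algebra: scalars, sums, congruent upper triangular matrices -/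

section SlashAlgebra

/-- **Slashing by a positive real scalar**: `f ∣[k] ((r • 1) M) = r^{k-2} (f ∣[k] M)` for `r > 0`
(the slash action carries `|det|^{k-1} = r^{2k-2}` and `j(r • 1, τ)^{-k} = r^{-k}`). [folklore] -/
theorem slash_realScalarGL_mul (k : ℤ) (f : ℍ → ℂ) {r : ℝ} (hr : 0 < r) (M : GL (Fin 2) ℝ) :
    f ∣[k] (realScalarGL r hr * M) = ((r : ℂ) ^ (k - 2)) • (f ∣[k] M) := by
  have hscal : f ∣[k] realScalarGL r hr = ((r : ℂ) ^ (k - 2)) • f := by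
    funext τ
    have hdet : 0 < (realScalarGL r hr).det.val := by rw [det_realScalarGL]; positivity
    have hact : realScalarGL r hr • τ = τ := by
      have := realScalarGL_mul_smul r hr (g := 1) (by simp) τ
      rwa [mul_one, one_smul] at this
    have hden : UpperHalfPlane.denom (realScalarGL r hr) τ = r := by
      have := denom_realScalarGL_mul r hr 1 τ
      rw [mul_one] at this
      rw [this]
      simp [UpperHalfPlane.denom]
    rw [slash_apply_of_det_pos k f hdet, hact, hden, det_realScalarGL, Pi.smul_apply, smul_eq_mul]
    have hr' : ((r : ℝ) : ℂ) ≠ 0 := by exact_mod_cast hr.ne'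
    push_cast
    rw [← zpow_natCast, ← _root_.zpow_mul, mul_assoc, ← zpow_add₀ hr', mul_comm]
    congr 2
    push_cast; ring
  rw [SlashAction.slash_mul, hscal, ModularForm.smul_slash]
  congr 1
  rw [← Complex.ofReal_zpow, UpperHalfPlane.σ_ofReal]

/-- Slashing a finite sum. [folklore] -/
theorem finset_sum_slash {ι : Type*} (k : ℤ) (s : Finset ι) (F : ι → ℍ → ℂ) (M : GL (Fin 2) ℝ) :
    (∑ i ∈ s, F i) ∣[k] M = ∑ i ∈ s, F i ∣[k] M := by
  classical
  induction s using Finset.induction_on with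
  | empty => simp [SlashAction.zero_slash]
  | insert a s ha ih => rw [Finset.sum_insert ha, Finset.sum_insert ha, SlashAction.add_slash, ih]

variable {N : ℕ} {k : ℤ}

/-- **Congruent translations give the same slash**: for `f` of level `Γ₁(N)` and `p ∣ y - x`,
`f ∣[k] (1 x; 0 p) = f ∣[k] (1 y; 0 p)` (`tpB p x = (1 x; 0 p)` of `HeckeOperatorsProofs`), since
`(1 y; 0 p) = T^{(y-x)/p} (1 x; 0 p)` with `T ∈ Γ₁(N)`. [folklore] -/
theorem slash_tpB_congr {F : Type*} [FunLike F ℍ ℂ] [SlashInvariantFormClass F (Gamma1 N) k] (f : F)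
    {p : ℕ} [NeZero p] {x y : ℤ} (hxy : (p : ℤ) ∣ y - x) :
    (⇑f : ℍ → ℂ) ∣[k] tpB p x = (⇑f : ℍ → ℂ) ∣[k] tpB p y := by
  obtain ⟨t, ht⟩ := hxy
  have he : tpB p y = Matrix.SpecialLinearGroup.mapGL ℝ (ModularGroup.T ^ t) * tpB p x := by
    ext i j
    rw [Units.val_mul, val_mapGL', ModularGroup.coe_T_zpow, val_tpB, val_tpB]
    have hy : (y : ℝ) = x + t * p := by
      have : (y : ℤ) = x + p * t := by linarith
      rw [this]; push_cast; ring
    fin_cases i <;> fin_cases j <;> simp [Matrix.mul_apply, Fin.sum_univ_two, hy]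
  rw [he, SlashAction.slash_mul,
    SlashInvariantForm.slash_action_eqn f _ (Subgroup.mem_map_of_mem _ (HeckeTGamma1.T_zpow_mem_Gamma1 N t))]

/-- Reindexing `j ↦ -j (mod p)`: `∑_{j<p} f ∣[k] (1 -j; 0 p) = ∑_{j<p} f ∣[k] (1 j; 0 p)`. [folklore] -/
theorem sum_slash_tpB_neg {F : Type*} [FunLike F ℍ ℂ] [SlashInvariantFormClass F (Gamma1 N) k] (f : F)
    (p : ℕ) [NeZero p] :
    ∑ j : Fin p, (⇑f : ℍ → ℂ) ∣[k] tpB p (-((j : ℕ) : ℤ)) = ∑ j : Fin p, (⇑f : ℍ → ℂ) ∣[k] tpB p ((j : ℕ) : ℤ) := by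
  have h : ∀ j : Fin p, (⇑f : ℍ → ℂ) ∣[k] tpB p (-((j : ℕ) : ℤ)) =
      (⇑f : ℍ → ℂ) ∣[k] tpB p (((-j : Fin p) : ℕ) : ℤ) := fun j => by
    refine slash_tpB_congr f ?_
    have hsum : (((-j + j : Fin p) : ℕ) : ℤ) = 0 := by rw [neg_add_cancel]; simp
    rw [Fin.val_add] at hsum
    have hdvd : (p : ℤ) ∣ (((-j : Fin p) : ℕ) : ℤ) + j := by
      have h1 : (((((-j : Fin p) : ℕ) + (j : ℕ)) % p : ℕ) : ℤ) = 0 := hsum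
      have h2 := Nat.div_add_mod (((-j : Fin p) : ℕ) + (j : ℕ)) p
      refine ⟨((((-j : Fin p) : ℕ) + (j : ℕ)) / p : ℕ), ?_⟩
      have h3 : (((((-j : Fin p) : ℕ) + (j : ℕ)) % p : ℕ)) = 0 := by exact_mod_cast h1
      rw [h3, add_zero] at h2
      exact_mod_cast h2.symm
    simpa [sub_neg_eq_add] using hdvd
  simp_rw [h]
  exact Equiv.sum_comp (Equiv.neg (Fin p)) (fun j : Fin p => (⇑f : ℍ → ℂ) ∣[k] tpB p ((j : ℕ) : ℤ))

end SlashAlgebra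

/-! ### The classical identity `∑ⱼ f ∣[k] β_j⁻¹ = p^{2-k} a_p f` -/

section ClassicalSum

variable {N : ℕ} {k : ℤ} (p : ℕ) (hp : p.Prime) (a b' d' : ℤ) (had : a * d' - b' * N = 1)

/-- `det δ = 1` in `GL₂(ℝ)` for `δ ∈ SL₂(ℤ)`. [folklore] -/
theorem val_det_coe_GL (A : SL(2, ℤ)) : ((A : GL (Fin 2) ℝ)).det.val = 1 := by
  rw [Matrix.GeneralLinearGroup.val_det_apply]
  change (((A : SL(2, ℤ)) : Matrix (Fin 2) (Fin 2) ℤ).map (Int.castRingHom ℝ)).det = 1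
  rw [← RingHom.mapMatrix_apply, ← RingHom.map_det, A.det_coe, map_one]

/-- The real matrix of `β_j⁻¹`, `j < p`: `p⁻¹ • (1 -j; 0 p) = p⁻¹ • tpB p (-j)`. [folklore] -/
theorem map_castHom_heckeBeta_some_inv (j : Fin p) :
    haveI : NeZero p := ⟨hp.ne_zero⟩
    (Matrix.GeneralLinearGroup.map (Rat.castHom ℝ) (heckeBeta p a b' d' N hp.ne_zero had (some j)))⁻¹ =
      realScalarGL ((p : ℝ)⁻¹) (by have := hp.pos; positivity) * tpB p (-((j : ℕ) : ℤ)) := by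
  haveI : NeZero p := ⟨hp.ne_zero⟩
  rw [← map_inv]
  ext i l
  rw [Matrix.GeneralLinearGroup.map_apply, coe_heckeBeta_some_inv, realScalarGL_mul_apply, val_tpB]
  have hp' : (p : ℝ) ≠ 0 := by exact_mod_cast hp.ne_zero
  fin_cases i <;> fin_cases l <;> simp [hp', mul_comm]

/-- The real matrix of `β_∞⁻¹`: `p⁻¹ • (d' -b'; -N a) diag(p, 1)`, with `(d' -b'; -N a) = δ⁻¹ ∈ Γ₀(N)`
and `diag(p, 1) = tpD p` of `HeckeOperatorsProofs`. [folklore] -/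
theorem map_castHom_heckeBeta_none_inv :
    haveI : NeZero p := ⟨hp.ne_zero⟩
    (Matrix.GeneralLinearGroup.map (Rat.castHom ℝ) (heckeBeta p a b' d' N hp.ne_zero had none))⁻¹ =
      realScalarGL ((p : ℝ)⁻¹) (by have := hp.pos; positivity) *
        ((((bezoutDelta a b' d' N had)⁻¹ : SL(2, ℤ)) : GL (Fin 2) ℝ) * tpD p) := by
  haveI : NeZero p := ⟨hp.ne_zero⟩
  rw [← map_inv]
  ext i l
  rw [Matrix.GeneralLinearGroup.map_apply, coe_heckeBeta_none_inv, realScalarGL_mul_apply, Units.val_mul, val_tpD,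
    coe_GL_bezoutDelta_inv]
  have hp' : (p : ℝ) ≠ 0 := by exact_mod_cast hp.ne_zero
  fin_cases i <;> fin_cases l <;> simp [Matrix.mul_apply, Fin.sum_univ_two] <;> field_simp

include hp in
/-- **`⟨p⟩ f = χ(p) f`** for a newform `f` of nebentypus `χ` and `p ∤ N` (a unit mod `N`), granted
`IsNewform1.mem_nebentypusSubspace_nebentypus` (Diamond–Shurman §5.2, p. 169; the unconditional
form is `IsNewform1.diamondOp_natCast_apply_of_not_dvd` of `LanglandsTunnellLSeriesProofs`, whose
imports are avoided here). [cite: DiamondShurman2005, §5.2 p. 169] -/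
theorem diamondOp_natCast_eq_nebentypus_smul [NeZero N] (hB : IsNewform1.mem_nebentypusSubspace_nebentypus (N := N) (k := k))
    {f : CuspForm (Gamma1 N) k} (hf : IsNewform1 f) (hpN : ¬ p ∣ N) :
    diamondOp N k (p : ZMod N) f = nebentypus f (p : ZMod N) • f := by
  obtain ⟨u, hu⟩ := ZMod.isUnit_prime_of_not_dvd hp hpN
  have hmem := hB hf
  rw [nebentypusSubspace, Submodule.mem_iInf] at hmem
  have h1 := hmem u
  rwa [LinearMap.mem_ker, LinearMap.sub_apply, LinearMap.smul_apply, LinearMap.id_apply, sub_eq_zero, hu] at h1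

/-- **The classical identity behind Gelbart's Lemma 3.7**: for a newform `f ∈ S_k(Γ₁(N))`, `p ∤ N`
prime, and Bezout data `a d' - b' N = 1`, `N ∣ a - p`:
`∑ⱼ f ∣[k] β_j⁻¹ = p^{2-k} a_p(f) · f`, granted the nebentypus fact
(`IsNewform1.mem_nebentypusSubspace_nebentypus`). Indeed `β_j⁻¹ = p⁻¹ (1 -j; 0 p)`,
`β_∞⁻¹ = p⁻¹ (d' -b'; -N a) diag(p,1)` with `(d' -b'; -N a) ∈ Γ₀(N)` of lower right entry `a ≡ p`,
so the sum is `p^{2-k} (∑ⱼ f ∣ (1 j; 0 p) + χ(p) f ∣ diag(p,1)) = p^{2-k} T_p f = p^{2-k} a_p f` by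
Diamond–Shurman's Prop. 5.2.1 (`coe_heckeT_gamma1_eq_sum_of_not_dvd` of
`HeckeOperatorsGamma1QExpansionProofs`: `T_p f = (⟨p⟩ f) ∣ diag(p,1) + ∑ⱼ f ∣ (1 j; 0 p)`). [cite: DiamondShurman2005, Prop. 5.2.1] -/
theorem sum_slash_heckeBeta_inv [NeZero N] (hap : (N : ℤ) ∣ a - p)
    (hB : IsNewform1.mem_nebentypusSubspace_nebentypus (N := N) (k := k)) (hpN : ¬ p ∣ N)
    {f : CuspForm (Gamma1 N) k} (hf : IsNewform1 f) :
    ∑ j : Option (Fin p), (⇑f : ℍ → ℂ) ∣[k] (Matrix.GeneralLinearGroup.map (Rat.castHom ℝ)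
        (heckeBeta p a b' d' N hp.ne_zero had j))⁻¹ =
      ((p : ℂ) ^ (2 - k) * heckeEigenvalue f p) • (⇑f : ℍ → ℂ) := by
  haveI : NeZero p := ⟨hp.ne_zero⟩
  have hp' : (p : ℝ) ≠ 0 := by exact_mod_cast hp.ne_zero
  have hχ : nebentypus f ((a : ℤ) : ZMod N) = nebentypus f ((p : ℕ) : ZMod N) := by
    congr 1
    rw [← Int.cast_natCast]
    exact ((ZMod.intCast_eq_intCast_iff_dvd_sub (p : ℤ) a N).2 hap).symm
  -- the scalar `p⁻¹` contributes `p^{2-k}`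
  have hscalar : (((p : ℝ)⁻¹ : ℝ) : ℂ) ^ (k - 2) = (p : ℂ) ^ (2 - k) := by
    push_cast
    rw [_root_.inv_zpow', neg_sub]
  -- the terms `j < p`
  have hsome : ∀ j : Fin p, (⇑f : ℍ → ℂ) ∣[k] (Matrix.GeneralLinearGroup.map (Rat.castHom ℝ)
      (heckeBeta p a b' d' N hp.ne_zero had (some j)))⁻¹ =
      ((p : ℂ) ^ (2 - k)) • ((⇑f : ℍ → ℂ) ∣[k] tpB p (-((j : ℕ) : ℤ))) := fun j => by
    rw [map_castHom_heckeBeta_some_inv p hp a b' d' had j, slash_realScalarGL_mul, hscalar]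
  -- the term `∞`
  have hnone : (⇑f : ℍ → ℂ) ∣[k] (Matrix.GeneralLinearGroup.map (Rat.castHom ℝ)
      (heckeBeta p a b' d' N hp.ne_zero had none))⁻¹ =
      ((p : ℂ) ^ (2 - k) * nebentypus f ((p : ℕ) : ZMod N)) • ((⇑f : ℍ → ℂ) ∣[k] tpD p) := by
    rw [map_castHom_heckeBeta_none_inv p hp a b' d' had, slash_realScalarGL_mul, hscalar, SlashAction.slash_mul,
      slash_eq_nebentypus_smul_of_mem_gamma0 hB hf (bezoutDelta_inv_mem_gamma0 a b' d' N had),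
      bezoutDelta_inv_apply_one_one, ModularForm.smul_slash, hχ, smul_smul]
    congr 1
    rw [UpperHalfPlane.σ, if_pos (by rw [det_tpD]; exact_mod_cast hp.pos)]
    rfl
  -- Diamond–Shurman's formula, with `⟨p⟩ f = χ(p) f` on its first term
  have hT := coe_heckeT_gamma1_eq_sum_of_not_dvd N k p hp hpN f
  rw [diamondOp_natCast_eq_nebentypus_smul p hp hB hf hpN, CuspForm.IsGLPos.coe_smul, ModularForm.smul_slash] at hT
  have hσ : UpperHalfPlane.σ (tpD p) (nebentypus f ((p : ℕ) : ZMod N)) = nebentypus f ((p : ℕ) : ZMod N) := by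
    rw [UpperHalfPlane.σ, if_pos (by rw [det_tpD]; exact_mod_cast hp.pos)]
    rfl
  have hT' : (⇑(Literature.NumberTheory.EllipticCurves.ModularForms.heckeT (Gamma1 N) k p f) : ℍ → ℂ) =
      UpperHalfPlane.σ (tpD p) (nebentypus f ((p : ℕ) : ZMod N)) • ((⇑f : ℍ → ℂ) ∣[k] tpD p) +
        ∑ j : Fin p, (⇑f : ℍ → ℂ) ∣[k] tpB p ((j : ℕ) : ℤ) := hT
  rw [hσ] at hT'
  have heigen : Literature.NumberTheory.EllipticCurves.ModularForms.heckeT (Gamma1 N) k p f = heckeEigenvalue f p • f :=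
    heckeT_eq_heckeEigenvalue_smul f p (hf.2.1 p hp)
  have hTfun : (⇑(Literature.NumberTheory.EllipticCurves.ModularForms.heckeT (Gamma1 N) k p f) : ℍ → ℂ) = heckeEigenvalue f p • (⇑f : ℍ → ℂ) := by
    rw [heigen, CuspForm.IsGLPos.coe_smul]
  -- assemble
  rw [Fintype.sum_option, hnone]
  simp_rw [hsome]
  rw [← Finset.smul_sum, sum_slash_tpB_neg f p, mul_smul, ← smul_add, ← hT', hTfun, smul_smul]

/-- **The archimedean form of the Hecke identity**: for `det x > 0`,
`∑ⱼ archLift k f (β_j⁻¹ x) = (a_p / (√p)^{k-2}) · archLift k f x` (`archLift k f (β⁻¹ x) =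
(f ∣[k] β⁻¹ ∣[k] x)(i) · (√(det x / p))^{2-k}` and `sum_slash_heckeBeta_inv`). [folklore] -/
theorem sum_archLift_heckeBeta_inv_mul [NeZero N] (hap : (N : ℤ) ∣ a - p)
    (hB : IsNewform1.mem_nebentypusSubspace_nebentypus (N := N) (k := k)) (hpN : ¬ p ∣ N)
    {f : CuspForm (Gamma1 N) k} (hf : IsNewform1 f) {x : GL (Fin 2) ℝ} (hx : 0 < x.det.val) :
    ∑ j : Option (Fin p), archLift k f ((Matrix.GeneralLinearGroup.map (Rat.castHom ℝ)
        (heckeBeta p a b' d' N hp.ne_zero had j))⁻¹ * x) =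
      (heckeEigenvalue f p / (((Real.sqrt p : ℝ) : ℂ) ^ (k - 2))) * archLift k f x := by
  have hp0 : (0 : ℝ) < p := by exact_mod_cast hp.pos
  have hdetB : ∀ j, ((Matrix.GeneralLinearGroup.map (Rat.castHom ℝ) (heckeBeta p a b' d' N hp.ne_zero had j))⁻¹ * x).det.val =
      x.det.val / p := fun j => by
    rw [map_mul, map_inv, Units.val_mul, Units.val_inv_eq_inv_val, Matrix.GeneralLinearGroup.map_det, Units.coe_map,
      MonoidHom.coe_coe, val_det_heckeBeta, Rat.coe_castHom, Rat.cast_natCast, inv_mul_eq_div]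
  have hterm : ∀ j, archLift k f ((Matrix.GeneralLinearGroup.map (Rat.castHom ℝ)
      (heckeBeta p a b' d' N hp.ne_zero had j))⁻¹ * x) =
      (((⇑f : ℍ → ℂ) ∣[k] (Matrix.GeneralLinearGroup.map (Rat.castHom ℝ) (heckeBeta p a b' d' N hp.ne_zero had j))⁻¹) ∣[k] x)
        UpperHalfPlane.I * ((Real.sqrt (x.det.val / p) : ℝ) : ℂ) ^ (2 - k) := fun j => by
    rw [archLift_apply, SlashAction.slash_mul, hdetB, abs_of_pos (div_pos hx hp0)]
  simp_rw [hterm]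
  rw [← Finset.sum_mul, ← Finset.sum_apply, ← finset_sum_slash, sum_slash_heckeBeta_inv p hp a b' d' had hap hB hpN hf,
    ModularForm.smul_slash, UpperHalfPlane.σ, if_pos hx, archLift_apply, abs_of_pos hx, Pi.smul_apply, smul_eq_mul]
  change (p : ℂ) ^ (2 - k) * heckeEigenvalue f p * ((⇑f : ℍ → ℂ) ∣[k] x) UpperHalfPlane.I * _ = _
  -- the powers of `√p`
  have hsp : (0 : ℝ) < Real.sqrt p := Real.sqrt_pos.2 hp0
  have hsp' : ((Real.sqrt p : ℝ) : ℂ) ≠ 0 := by exact_mod_cast hsp.ne'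
  have hpC : (p : ℂ) = ((Real.sqrt p : ℝ) : ℂ) ^ (2 : ℤ) := by
    rw [zpow_two, ← Complex.ofReal_mul, Real.mul_self_sqrt hp0.le]; push_cast; ring
  rw [Real.sqrt_div' _ hp0.le, Complex.ofReal_div, div_zpow, hpC, ← _root_.zpow_mul]
  have hkey : ((Real.sqrt p : ℝ) : ℂ) ^ (2 * (2 - k)) * (((Real.sqrt p : ℝ) : ℂ) ^ (2 - k))⁻¹ =
      (((Real.sqrt p : ℝ) : ℂ) ^ (k - 2))⁻¹ := by
    rw [← _root_.zpow_neg, ← _root_.zpow_neg, ← zpow_add₀ hsp']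
    congr 1; ring
  simp only [div_eq_mul_inv]
  linear_combination (heckeEigenvalue f p * ((⇑f : ℍ → ℂ) ∣[k] x) UpperHalfPlane.I *
    ((Real.sqrt x.det.val : ℝ) : ℂ) ^ (2 - k)) * hkey

end ClassicalSum

end Literature.NumberTheory.Automorphic
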